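import Summits.AtomisticToContinuum.HydrodynamicLimit.Theorems.SpeedCapSurgeryEquilibriumMaxSpeed
import Summits.AtomisticToContinuum.HydrodynamicLimit.Theorems.SpeedCapSurgeryMaxSpeedBoundLogRareOfTailsOneRare
import HarnessLib

/-!
# `TailsToMaxSpeedR` (stmt-16990): Gaussian tails + one-rare contact ceiling ⇒ the speed cap

This file CLOSES the route item `TailsToMaxSpeedR` (stmt-AtomisticToContinuum-16990) of
`SpeedCapSurgery`: the glue `GaussianVelocityTails → ContactIntensityDominationOneRare →
MaxSpeedBoundLog`, by the `MaxSpeedBoundLog` crux line `registered` (stmt-9629): its composition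
`exists_speedCap_of` (file `SpeedCapSurgeryEquilibriumMaxSpeed`) fed with the landed static tail
`stub_initialSpeedTailLog`, the landed pathwise record lemma `stub_energeticCollisionRecord`, and the
dynamic stub derived from the two hypotheses, `energeticCollisionsRare_of`
(file `SpeedCapSurgeryMaxSpeedBoundLogRareOfTailsOneRare`). In particular the crux `MaxSpeedBoundLog`
is now reduced, sorry-free, to the two open route items stmt-9633 and stmt-16939.
-/

noncomputable section

namespace Summit.AtomisticToContinuum.HydrodynamicLimit.Theorems.MaxSpeedBoundLogLine

open Literature.MathematicalPhysics.KineticTheory Literature.Analysis.FluidPDE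

/-- **`TailsToMaxSpeedR` (stmt-AtomisticToContinuum-16990): the glue
`GaussianVelocityTails → ContactIntensityDominationOneRare → MaxSpeedBoundLog`.** The line's
composition `exists_speedCap_of` fed with the landed static tail `stub_initialSpeedTailLog`, the
landed record lemma `stub_energeticCollisionRecord`, and the dynamic stub derived from the two
hypotheses, `energeticCollisionsRare_of`. -/
theorem tailsToMaxSpeedR_proof :
    Summit.AtomisticToContinuum.HydrodynamicLimit.Theses.SpeedCapSurgery.TailsToMaxSpeedR := by
  intro hT hO a₀ θ₀ u₀ ha hθ hu hap hθp
  obtain ⟨σ₀, hσ₀, H⟩ := energeticCollisionsRare_of hT hO a₀ θ₀ u₀ ha hθ hu hap hθp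
  refine ⟨σ₀, hσ₀, fun σ hσ hσlt t ht Φ => ?_⟩
  exact exists_speedCap_of
    (Summit.AtomisticToContinuum.HydrodynamicLimit.Cruxes.MaxSpeedBoundLog.Birth.stub_initialSpeedTailLog
      a₀ θ₀ u₀ ha hθ hu hap hθp σ hσ Φ)
    (fun N z hz c =>
      Summit.AtomisticToContinuum.HydrodynamicLimit.Theorems.MaxSpeedBoundLogBirth.stub_energeticCollisionRecord
        σ N (Φ N) z hz c t)
    (H σ hσ hσlt t ht Φ)

end Summit.AtomisticToContinuum.HydrodynamicLimit.Theorems.MaxSpeedBoundLogLine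

end
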